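import Literature.Computability.AlgebraicComplexity.BorderRankExtensionSieve
import Literature.Computability.AlgebraicComplexity.BorderRankRestriction
import HarnessLib

/-!
# The linear extension sieve, II: row roles and one forced direction

Topic `Literature/Computability/AlgebraicComplexity`; a trunk-independent TOOL continuing
`BorderRankExtensionSieve.lean` (lemma (E1) of `BorderRankExtension.lean`: a tensor
`t ∈ K^ι ⊗ K^κ ⊗ K^μ` with `|ι| < r = bR(t)` has a new slice `Z ∉ V = t(A^*)` with
`bR(t + e_new ⊗ Z) ≤ r`; a TIGHT Koszul role — old rank already `C(q-1,p)·r` — forces linear conditions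
`Λ Z = 0`).  Two additions, both PROVED over an arbitrary field:

* **Row roles.** In `BorderRankExtensionSieve.lean` the extended factor is the SOURCE of the Koszul
  flattening (a new slice adds new COLUMNS; conditions come from LEFT-kernel vectors).  Here the extended
  factor indexes the ROWS together with the `(p+1)`-subsets (`rowFlattening q p M s`): a new slice adds
  new ROWS, linear in `Z` (`rowFlattening_extendSlice_none`), and when the old rows already have rank
  `C(q-1,p)·r` every RIGHT-kernel vector `x` of the old matrix kills the new rows
  (`rowFlattening_condition`, from the row sieve `mulVec_eq_zero_of_rank_le`).  On codes (`q = 4`,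
  `p = 1`) these are roles `2` (exterior map on the second factor, source the third) and `4` (exterior
  map on the third factor, source the second); roles `1`, `3` are the source roles of
  `SieveCert.lamEntry`.  `SieveCert.checkR` / `SieveCert.lt_algBorderRank_of_checkR` is the four-role
  depth-0 certificate (`ker Λ = V` ⇒ `bR > r`).
* **One forced direction.** If `ker Λ = V ⊕ K·Z₀` then every admissible `Z` is `l·Z₀ + v`, `l ≠ 0`,
  `v ∈ V`, and `bR(t + e_new ⊗ Z) = bR(t + e_new ⊗ Z₀)` (`algBorderRank_extendSlice_congr`); so a lower
  bound `r < bR(T + e_new ⊗ Z₀)` for the ONE explicit integer tensor `SieveCert.extendInt T Z₀` (any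
  certificate — a flattening, or at full size `r × r × r` the 111-equations of Buczyńska–Buczyński /
  Jelisiejew–Landsberg–Pal, `OneOneOneCertificate.lean`) gives `r < bR(T)`:
  `SieveCert.checkForcedR` / `SieveCert.lt_algBorderRank_of_checkForcedR` (certificate: the four-role
  condition part, `Λ` kills the slices and `Z₀`, `rank Λ ≥ bc - a - 1`, the `a+1` slices of
  `T + e_new ⊗ Z₀` independent — unit-pivot row certificates, every characteristic).

HONEST FRAMING (pub-tensor bundle): a THEOREM-level tool for CERTIFICATES about explicit small tensors
(row `T4-857` of the tight-`[4]^3` census: format `3 × 4 × 4`, `bR = 5`), NOT progress on the exponent of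
matrix multiplication.

## References

* J. Jagiełła, J. Jelisiejew, *Unrestrictions and concise secant varieties*, arXiv:2604.24879 (2026),
  Thm. 2.2, Lemma 2.7 [JagiellaJelisiejew2026Unrestrictions].
* J. M. Landsberg, G. Ottaviani, *New lower bounds for the border rank of matrix multiplication*,
  Theory of Computing 11 (2015), Thm. 2.1 [LandsbergOttaviani2015].
* J. M. Landsberg, *Geometry and complexity theory*, CUP 2017, §2.4.2 [LandsbergGCT2017].
* J. Jelisiejew, J. M. Landsberg, A. Pal, *Concise tensors of minimal border rank*, Math. Ann. (2023),
  §1 (111-equations), Prop. 3.3 (corank-one extensions) [JelisiejewLandsbergPal2023].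
-/

open scoped BigOperators Matrix
open Matrix

namespace Literature.Computability.AlgebraicComplexity

open Literature.LinearAlgebra.Matrix

universe u

/-! ## A. The row sieve -/

section LinAlg

variable {K : Type*} [Field K]

/-- **Row sieve.** If some rows of `M` (selected by `f`) already have rank `≥ cap ≥ rank M`, then every
vector `x` killed by the selected rows is killed by ALL rows of `M`. [folklore] -/
theorem mulVec_eq_zero_of_rank_le {m n m₀ : Type*} [Fintype m] [Fintype n] [Fintype m₀]
    (M : Matrix m n K) (f : m₀ → m) (x : n → K) (hx : M.submatrix f id *ᵥ x = 0) {cap : ℕ}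
    (hcap : cap ≤ (M.submatrix f id).rank) (hM : M.rank ≤ cap) : M *ᵥ x = 0 := by
  classical
  have h1 : x ᵥ* Mᵀ.submatrix id f = 0 := by
    rw [← Matrix.transpose_submatrix, Matrix.vecMul_transpose]; exact hx
  have h2 : cap ≤ (Mᵀ.submatrix id f).rank := by
    rw [← Matrix.transpose_submatrix, Matrix.rank_transpose]; exact hcap
  have h3 : Mᵀ.rank ≤ cap := by rw [Matrix.rank_transpose]; exact hM
  have key := vecMul_eq_zero_of_rank_le Mᵀ f x h1 h2 h3
  rwa [Matrix.vecMul_transpose] at key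

end LinAlg

/-! ## B. The Koszul flattening with the extended factor indexing the ROWS -/

section RowRole

variable {K : Type u} [Field K] {ι κ μ : Type} [Fintype κ]

/-- The Koszul flattening `Λ^p K^q ⊗ (K^μ)^* → Λ^{p+1} K^q ⊗ K^ι'` of `s ∈ K^ι' ⊗ K^κ ⊗ K^μ` in the role
"exterior factor `κ` (through `M : K^κ → K^q`), source `μ`, ROWS `ι'`" — a new slice along `ι'` enters
through new ROWS only. [cite: LandsbergGCT2017, §2.4.2 (2.4.5)-(2.4.6)] -/
def rowFlattening (q p : ℕ) {ι' : Type} (M : Matrix (Fin q) κ K) (s : ι' → κ → μ → K) :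
    Matrix (PSub q (p + 1) × ι') (PSub q p × μ) K :=
  koszulFlatteningGen q p M.mulVecLin (fun b c a => s a b c)

/-- The old rows of the flattening of `extendSlice t Z` form the flattening of `t`. [folklore] -/
theorem rowFlattening_extendSlice_submatrix (q p : ℕ) (M : Matrix (Fin q) κ K) (t : ι → κ → μ → K)
    (Z : κ → μ → K) :
    (rowFlattening q p M (extendSlice t Z)).submatrix (fun x : PSub q (p + 1) × ι => (x.1, some x.2))
      id = rowFlattening q p M t := by
  ext r x
  rfl

/-- The new row `(T, new)` of the flattening of `extendSlice t Z`: entry `(M(Z(·, m)) ∧ e_S)_T` at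
column `(S, m)` — linear in `Z`, independent of `t`. [folklore] -/
theorem rowFlattening_extendSlice_none (q p : ℕ) (M : Matrix (Fin q) κ K) (t : ι → κ → μ → K)
    (Z : κ → μ → K) (T : PSub q (p + 1)) (cc : PSub q p × μ) :
    rowFlattening q p M (extendSlice t Z) (T, none) cc =
      ∑ k, (∑ x, (wedgeInc T.1 cc.1.1 x : K) * M x k) * Z k cc.2 := by
  show wedgeMatrix (M.mulVecLin fun b => Z b cc.2) T.1 cc.1.1 = _
  rw [wedgeMatrix_eq_sum_wedgeInc]
  simp only [Matrix.mulVecLin_apply, Matrix.mulVec, dotProduct, Finset.mul_sum, Finset.sum_mul]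
  rw [Finset.sum_comm]
  refine Finset.sum_congr rfl fun j _ => Finset.sum_congr rfl fun x _ => ?_
  ring

variable [Fintype ι] [Fintype μ] [DecidableEq ι] [DecidableEq κ] [DecidableEq μ]

/-- **Landsberg–Ottaviani in the row role**: `rank ≤ C(q-1, p) · bR(s)` (the arrangement
`(b, c, a) ↦ s a b c = rotate s` has the border rank of `s`). [cite: LandsbergOttaviani2015, Thm 2.1] [cite: Blaser2013, §5.1 (permutation of tensors)] -/
theorem rank_rowFlattening_le (q p : ℕ) {ι' : Type} [Fintype ι'] [DecidableEq ι']
    (M : Matrix (Fin q) κ K) (s : ι' → κ → μ → K) :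
    (rowFlattening q p M s).rank ≤ (q - 1).choose p * algBorderRank s := by
  have h := rank_koszulFlatteningGen_le_choose_mul_algBorderRank q p M (fun b c a => s a b c)
  have e : algBorderRank (fun b c a => s a b c) = algBorderRank s := algBorderRank_rotate s
  rw [e] at h
  exact h

/-- **The linear condition of a tight row role.** If `bR(extendSlice t Z) ≤ r`, the old rows already
have rank `≥ C(q-1,p) · r`, and `x` is a right-kernel vector of the old matrix, then every new row
kills `x`: for the row `(T, new)`, `∑_{(S,m)} x(S,m) · ∑_k (∑_x' ε(T,S,x') M_{x'k}) · Z_{km} = 0`.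
[cite: LandsbergOttaviani2015, Thm 2.1] [cite: JagiellaJelisiejew2026Unrestrictions, Thm. 2.2 (use of the extension)] -/
theorem rowFlattening_condition (q p : ℕ) (M : Matrix (Fin q) κ K) (t : ι → κ → μ → K)
    (Z : κ → μ → K) {r : ℕ} (hZ : algBorderRank (extendSlice t Z) ≤ r)
    (hcap : (q - 1).choose p * r ≤ (rowFlattening q p M t).rank) (x : PSub q p × μ → K)
    (hx : rowFlattening q p M t *ᵥ x = 0) (T : PSub q (p + 1)) :
    ∑ cc : PSub q p × μ, x cc * ∑ k, (∑ x', (wedgeInc T.1 cc.1.1 x' : K) * M x' k) * Z k cc.2 = 0 := by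
  have hrank : (rowFlattening q p M (extendSlice t Z)).rank ≤ (q - 1).choose p * r :=
    (rank_rowFlattening_le q p M (extendSlice t Z)).trans (Nat.mul_le_mul_left _ hZ)
  have hcap' : (q - 1).choose p * r ≤ ((rowFlattening q p M (extendSlice t Z)).submatrix
      (fun x : PSub q (p + 1) × ι => (x.1, some x.2)) id).rank := by
    rw [rowFlattening_extendSlice_submatrix]; exact hcap
  have hx' : (rowFlattening q p M (extendSlice t Z)).submatrix
      (fun x : PSub q (p + 1) × ι => (x.1, some x.2)) id *ᵥ x = 0 := by
    rw [rowFlattening_extendSlice_submatrix]; exact hx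
  have key := congr_fun (mulVec_eq_zero_of_rank_le _ _ x hx' hcap' hrank) (T, none)
  simp only [Matrix.mulVec, dotProduct, Pi.zero_apply, rowFlattening_extendSlice_none] at key
  rw [← key]
  exact Finset.sum_congr rfl fun cc _ => mul_comm _ _

end RowRole

/-! ## C. Integer certificates on codes: four roles, depth 0 and depth 1 -/

namespace SieveCert

open KYCert KYGen

/-- The linear form of a condition `(role, v, s)` at coordinate `(j, l)` of the new slice, FOUR roles:
roles `1`, `3` = the source roles of `lamEntry` (`v` = left-kernel vector on row codes, `s` = singleton
of the new column); role `2`: exterior map `M1` on the second factor, source = third factor, the extended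
first factor indexes ROWS (`v` = right-kernel vector on column codes `S * c + l`, `s` = PAIR code `< 6` of
the new row): `∑_{(q,λ) ∈ v, q % c = l} λ · ∑_x ε(s, q / c, x) M1[x][j]`; role `4`: the same with
exterior map `M3` on the third factor and source the second. [cite: LandsbergOttaviani2015, Thm 2.1] -/
def lamEntryR (b c : ℕ) (M1 M3 : List (List ℤ)) (cd : Cond) (j l : ℕ) : ℤ :=
  if cd.1 = 2 then
    (cd.2.1.map fun qc => if qc.1 % c = l then
        qc.2 * lsum 4 (fun x => incZ4 (cd.2.2 % 6) (qc.1 / c % 4) x * mget M1 x j) else 0).sum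
  else if cd.1 = 4 then
    (cd.2.1.map fun qc => if qc.1 % b = j then
        qc.2 * lsum 4 (fun x => incZ4 (cd.2.2 % 6) (qc.1 / b % 4) x * mget M3 x l) else 0).sum
  else lamEntry b c M1 M3 cd j l

/-- `Λ` on codes (four roles): row `k`, column code `q = j*c + l`. [folklore] -/
def lamCodeR (b c : ℕ) (M1 M3 : List (List ℤ)) (conds : List Cond) (k q : ℕ) : ℤ :=
  lamEntryR b c M1 M3 (conds.getD (k % (b * c)) dflt) (q / c % b) (q % c)

/-- `Λ` (four roles) as an integer matrix. [folklore] -/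
def lamMatR (b c : ℕ) (M1 M3 : List (List ℤ)) (conds : List Cond) :
    Matrix (Fin (b * c)) (Fin b × Fin c) ℤ :=
  Matrix.of fun k p => lamEntryR b c M1 M3 (conds.getD k dflt) p.1 p.2

/-- Vanishing of a condition's vector on the old flattening of its role, on codes (four roles; roles
`2`, `4`: `∑_{(q,λ)} λ · M0[rr][q] = 0` for every row code `rr < 6a`). [folklore] -/
def condVanishR (a b c : ℕ) [NeZero a] [NeZero b] [NeZero c] (T : Fin a → Fin b → Fin c → ℤ)
    (M1 M3 : List (List ℤ)) (cd : Cond) : Bool :=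
  if cd.1 = 2 then
    (List.range (6 * a)).all fun rr =>
      (cd.2.1.map fun qc => qc.2 * kyEntry4 b c a M1 (fun j l i => T i j l) rr qc.1).sum == 0
  else if cd.1 = 4 then
    (List.range (6 * a)).all fun rr =>
      (cd.2.1.map fun qc => qc.2 * kyEntry4 c b a M3 (fun l j i => T i j l) rr qc.1).sum == 0
  else condVanish a b c T M1 M3 cd

/-- `Λ` (four roles) kills every slice, on codes. [folklore] -/
def slicesKilledR (a b c : ℕ) [NeZero a] [NeZero b] [NeZero c] (T : Fin a → Fin b → Fin c → ℤ)
    (M1 M3 : List (List ℤ)) (conds : List Cond) : Bool :=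
  (List.range (b * c)).all fun k => (List.range a).all fun i =>
    lsum b (fun j => lsum c fun l =>
      lamEntryR b c M1 M3 (conds.getD k dflt) j l * T (finCode a i) (finCode b j) (finCode c l)) == 0

/-- The four rank certificates of the condition part: each role in use has old flattening rank `≥ 3r`
(unit-pivot row certificates of the `kyEntry4` presentations). [cite: LandsbergOttaviani2015, Thm 2.1] -/
def capsR (a b c r : ℕ) [NeZero a] [NeZero b] [NeZero c] (T : Fin a → Fin b → Fin c → ℤ)
    (M1 M3 : List (List ℤ)) (conds : List Cond) (rows1 : List (List (ℕ × ℤ))) (piv1 : List ℕ)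
    (rows2 : List (List (ℕ × ℤ))) (piv2 : List ℕ) (rows3 : List (List (ℕ × ℤ))) (piv3 : List ℕ)
    (rows4 : List (List (ℕ × ℤ))) (piv4 : List ℕ) : Bool :=
  (!(conds.any fun cd => cd.1 == 1) ||
    intTriCheckUnit (3 * r) (kyEntry4 b a c M1 (fun j i l => T i j l)) rows1 piv1) &&
  (!(conds.any fun cd => cd.1 == 2) ||
    intTriCheckUnit (3 * r) (kyEntry4 b c a M1 (fun j l i => T i j l)) rows2 piv2) &&
  (!(conds.any fun cd => !(cd.1 == 1) && !(cd.1 == 2) && !(cd.1 == 4)) ||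
    intTriCheckUnit (3 * r) (kyEntry4 c a b M3 (fun l i j => T i j l)) rows3 piv3) &&
  (!(conds.any fun cd => cd.1 == 4) ||
    intTriCheckUnit (3 * r) (kyEntry4 c b a M3 (fun l j i => T i j l)) rows4 piv4)

/-- **Depth-0 sieve certificate, four roles** (`ker Λ = V`): conditions vanish on their old
flattenings, caps, `Λ` kills the slices, `rank Λ ≥ bc - a`, slice rank `≥ a`. [cite: JagiellaJelisiejew2026Unrestrictions, Thm. 2.2] [cite: LandsbergOttaviani2015, Thm 2.1] -/
def checkR (a b c r : ℕ) [NeZero a] [NeZero b] [NeZero c] (T : Fin a → Fin b → Fin c → ℤ)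
    (M1 M3 : List (List ℤ)) (conds : List Cond) (rows1 : List (List (ℕ × ℤ))) (piv1 : List ℕ)
    (rows2 : List (List (ℕ × ℤ))) (piv2 : List ℕ) (rows3 : List (List (ℕ × ℤ))) (piv3 : List ℕ)
    (rows4 : List (List (ℕ × ℤ))) (piv4 : List ℕ) (rowsL : List (List (ℕ × ℤ))) (pivL : List ℕ)
    (rowsS : List (List (ℕ × ℤ))) (pivS : List ℕ) : Bool :=
  (conds.all fun cd => condVanishR a b c T M1 M3 cd) &&
  capsR a b c r T M1 M3 conds rows1 piv1 rows2 piv2 rows3 piv3 rows4 piv4 &&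
  slicesKilledR a b c T M1 M3 conds &&
  intTriCheckUnit (b * c - a) (lamCodeR b c M1 M3 conds) rowsL pivL &&
  intTriCheckUnit a (slabCode a b c T) rowsS pivS

/-- `Fin (a+1) → Option (Fin a)`: `i < a ↦ some i`, `a ↦ none` (the new index LAST). [folklore] -/
def optOfFin (a : ℕ) (i : Fin (a + 1)) : Option (Fin a) :=
  if h : (i : ℕ) < a then some ⟨i, h⟩ else none

/-- The integer tensor `T + e_a ⊗ Z₀` of format `(a+1) × b × c` (`Z₀` as integer row lists). [folklore] -/
def extendInt {a b c : ℕ} (T : Fin a → Fin b → Fin c → ℤ) (Z0 : List (List ℤ)) :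
    Fin (a + 1) → Fin b → Fin c → ℤ :=
  fun i j l => (optOfFin a i).elim (mget Z0 j l) (fun i' => T i' j l)

/-- `Λ Z₀ = 0` on codes (four roles). [folklore] -/
def lamKillsR (b c : ℕ) (M1 M3 : List (List ℤ)) (conds : List Cond) (Z0 : List (List ℤ)) : Bool :=
  (List.range (b * c)).all fun k =>
    lsum b (fun j => lsum c fun l => lamEntryR b c M1 M3 (conds.getD k dflt) j l * mget Z0 j l) == 0

/-- **Depth-1 (one forced direction) sieve certificate, four roles**, for `r < bR(T)` GIVEN
`r < bR(T + e_new ⊗ Z₀)`: the condition part; `Λ` kills the slices and `Z₀`; `rank Λ ≥ bc - a - 1`;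
the `a + 1` slices of `T + e_new ⊗ Z₀` have rank `a + 1`. [cite: JagiellaJelisiejew2026Unrestrictions, Thm. 2.2] [cite: LandsbergOttaviani2015, Thm 2.1] -/
def checkForcedR (a b c r : ℕ) [NeZero a] [NeZero b] [NeZero c] (T : Fin a → Fin b → Fin c → ℤ)
    (Z0 : List (List ℤ)) (M1 M3 : List (List ℤ)) (conds : List Cond) (rows1 : List (List (ℕ × ℤ)))
    (piv1 : List ℕ) (rows2 : List (List (ℕ × ℤ))) (piv2 : List ℕ) (rows3 : List (List (ℕ × ℤ)))
    (piv3 : List ℕ) (rows4 : List (List (ℕ × ℤ))) (piv4 : List ℕ) (rowsL : List (List (ℕ × ℤ)))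
    (pivL : List ℕ) (rowsS : List (List (ℕ × ℤ))) (pivS : List ℕ) : Bool :=
  (conds.all fun cd => condVanishR a b c T M1 M3 cd) &&
  capsR a b c r T M1 M3 conds rows1 piv1 rows2 piv2 rows3 piv3 rows4 piv4 &&
  slicesKilledR a b c T M1 M3 conds &&
  lamKillsR b c M1 M3 conds Z0 &&
  intTriCheckUnit (b * c - a - 1) (lamCodeR b c M1 M3 conds) rowsL pivL &&
  intTriCheckUnit (a + 1) (slabCode (a + 1) b c (extendInt T Z0)) rowsS pivS

/-! ### Soundness -/

section Sound

variable {K : Type u} [Field K]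

/-- Every row of the role flattening is a decoded code `< 6a`. [folklore] -/
theorem exists_rowDec4 (a : ℕ) [NeZero a] (row : PSub 4 2 × Fin a) :
    ∃ rr, rr < 6 * a ∧ rowDec4 a rr = row := by
  obtain ⟨P, i⟩ := row
  obtain ⟨p, rfl⟩ : ∃ p : Fin 6, pairOf4 p = P := by
    revert P; decide
  have ha : 0 < a := Nat.pos_of_ne_zero (NeZero.ne a)
  refine ⟨a * p + i, ?_, ?_⟩
  · have hp : (p : ℕ) + 1 ≤ 6 := p.isLt
    calc a * p + i < a * p + a := by omega
      _ = a * (p + 1) := by ring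
      _ ≤ a * 6 := Nat.mul_le_mul_left _ hp
      _ = 6 * a := by ring
  · have h1 : (a * p + i) / a = p := by
      rw [Nat.mul_add_div ha, Nat.div_eq_of_lt i.isLt, add_zero]
    have h2 : finCode 6 ((a * ↑p + ↑i) / a) = p := by
      rw [h1]; exact Fin.ext (Nat.mod_eq_of_lt p.isLt)
    have h3 : finCode a (a * ↑p + ↑i) = i := by
      refine Fin.ext ?_
      show (a * ↑p + ↑i) % a = i
      rw [Nat.mul_add_mod, Nat.mod_eq_of_lt i.isLt]
    simp only [rowDec4, h2, h3]

/-- The role-2 flattening over `K` is the base change of the integer one presented by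
`kyEntry4 b c a M (j,l,i ↦ T i j l)`. [cite: LandsbergGCT2017, §2.4.2 (2.4.6)] -/
theorem rowFlattening_eq_map {a b c : ℕ} (T : Fin a → Fin b → Fin c → ℤ) (M : List (List ℤ)) :
    rowFlattening 4 1 ((mat4 b M).map (Int.cast : ℤ → K)) (fun i j l => (T i j l : K)) =
      (koszulFlatteningGen 4 1 (mat4 b M).mulVecLin (fun j l i => T i j l)).map (Int.cast : ℤ → K) :=
  (koszulFlatteningGen_mulVecLin_map 4 1 (Int.castRingHom K) (mat4 b M) (fun j l i => T i j l)).symm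

/-- A unit-pivot row certificate of the integer role-2 flattening bounds the rank over `K`.
[cite: LandsbergOttaviani2015, Thm 2.1] -/
theorem le_rank_rowFlattening {a b c : ℕ} [NeZero a] [NeZero b] [NeZero c]
    (T : Fin a → Fin b → Fin c → ℤ) (M : List (List ℤ)) {n : ℕ} {rows : List (List (ℕ × ℤ))}
    {piv : List ℕ} (h : intTriCheckUnit n (kyEntry4 b c a M (fun j l i => T i j l)) rows piv = true) :
    n ≤ (rowFlattening 4 1 ((mat4 b M).map (Int.cast : ℤ → K)) (fun i j l => (T i j l : K))).rank := by
  have e : kyEntry4 b c a M (fun j l i => T i j l) = fun r q =>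
      koszulFlatteningGen 4 1 (mat4 b M).mulVecLin (fun j l i => T i j l) (rowDec4 a r) (colDec4 c q) :=
    funext fun r => funext fun q => kyEntry4_eq b c a M (fun j l i => T i j l) r q
  rw [e] at h
  rw [rowFlattening_eq_map]
  exact le_rank_of_intTriCheckUnit (F := K) _ (rowDec4 a) (colDec4 c) h

/-- A condition vector killed by the integer role-2 flattening on codes is killed over `K`. [folklore] -/
theorem rowFlattening_mulVec_eq_zero {a b c : ℕ} [NeZero a] [NeZero b] [NeZero c]
    (T : Fin a → Fin b → Fin c → ℤ) (M : List (List ℤ)) (v : List (ℕ × ℤ))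
    (h : ((List.range (6 * a)).all fun rr =>
      (v.map fun qc => qc.2 * kyEntry4 b c a M (fun j l i => T i j l) rr qc.1).sum == 0) = true) :
    rowFlattening 4 1 ((mat4 b M).map (Int.cast : ℤ → K)) (fun i j l => (T i j l : K)) *ᵥ
      intCertRow (F := K) (colDec4 c) v = 0 := by
  classical
  funext row
  obtain ⟨rr, hrr, rfl⟩ := exists_rowDec4 a row
  rw [List.all_eq_true] at h
  have h' := h rr (List.mem_range.2 hrr)
  simp only [beq_iff_eq] at h'
  rw [rowFlattening_eq_map]
  simp only [Matrix.mulVec, dotProduct, Matrix.map_apply, Pi.zero_apply]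
  rw [show (∑ x, ((koszulFlatteningGen 4 1 (mat4 b M).mulVecLin (fun j l i => T i j l)
      (rowDec4 a rr) x : ℤ) : K) * intCertRow (F := K) (colDec4 c) v x) =
      ∑ x, intCertRow (F := K) (colDec4 c) v x * ((koszulFlatteningGen 4 1 (mat4 b M).mulVecLin
      (fun j l i => T i j l) (rowDec4 a rr) x : ℤ) : K) from Finset.sum_congr rfl fun x _ => mul_comm _ _]
  rw [sum_intCertRow_mul (F := K) (colDec4 c)
    (fun x => koszulFlatteningGen 4 1 (mat4 b M).mulVecLin (fun j l i => T i j l) (rowDec4 a rr) x) v]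
  simp only [← kyEntry4_eq]
  rw [h', Int.cast_zero]

/-- The role-2 linear forms on codes ARE the new-row functionals of `rowFlattening_condition`. [folklore] -/
theorem sum_lamRow_one {b c : ℕ} [NeZero b] [NeZero c] (M : List (List ℤ)) (v : List (ℕ × ℤ))
    (pc : ℕ) (Z : Fin b → Fin c → K) :
    ∑ j : Fin b, ∑ l : Fin c,
      (((v.map fun qc => if qc.1 % c = (l : ℕ) then
          qc.2 * lsum 4 (fun x => incZ4 (pc % 6) (qc.1 / c % 4) x * mget M x j) else 0).sum : ℤ) : K) *
        Z j l =
      ∑ cc : PSub 4 1 × Fin c, intCertRow (F := K) (colDec4 c) v cc *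
        ∑ k, (∑ x, (wedgeInc (pairOf4 (finCode 6 pc)).1 cc.1.1 x : K) *
          ((mat4 b M).map (Int.cast : ℤ → K)) x k) * Z k cc.2 := by
  classical
  rw [sum_intCertRow_mul' (colDec4 c)]
  have hinc : ∀ (q : ℕ) (x : Fin 4), incZ4 (pc % 6) (q / c % 4) x =
      wedgeInc (pairOf4 (finCode 6 pc)).1 (singOf4 (finCode 4 (q / c))).1 x := by
    intro q x
    unfold wedgeInc
    exact incZ4_eq (finCode 6 pc) (finCode 4 (q / c)) x
  induction v with
  | nil => simp
  | cons qc v ih =>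
    simp only [List.map_cons, List.sum_cons, Int.cast_add, add_mul, Finset.sum_add_distrib, ih]
    congr 1
    have hl : ∀ l : Fin c, (qc.1 % c = (l : ℕ)) ↔ finCode c qc.1 = l := fun l =>
      ⟨fun h => Fin.ext h, fun h => by rw [← h]; rfl⟩
    simp only [hl, Int.cast_ite, Int.cast_zero, ite_mul, zero_mul, Finset.sum_ite_eq,
      Finset.mem_univ, if_true, Int.cast_mul, lsum_eq, Int.cast_sum, hinc, Finset.mul_sum]
    refine Finset.sum_congr rfl fun j _ => ?_
    simp only [mat4, Matrix.map_apply, Matrix.of_apply, colDec4]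
    rw [← Finset.mul_sum]
    ring

/-- Linear forms of the empty condition vanish (four roles). [folklore] -/
theorem lamEntryR_dflt (b c : ℕ) (M1 M3 : List (List ℤ)) (j l : ℕ) :
    lamEntryR b c M1 M3 dflt j l = 0 := by
  simp [lamEntryR, lamEntry, dflt]

/-- **The tight-role conditions, four roles, one condition.** If the condition's vector kills the old
flattening of its role (on codes), that role's cap certificate holds, and `bR(T + e_new ⊗ Z) ≤ r`, then
the condition's linear form kills `Z`. [cite: LandsbergOttaviani2015, Thm 2.1] [cite: JagiellaJelisiejew2026Unrestrictions, Thm. 2.2] -/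
theorem sum_lamEntryR_mul_eq_zero {a b c r : ℕ} [NeZero a] [NeZero b] [NeZero c]
    (T : Fin a → Fin b → Fin c → ℤ) {M1 M3 : List (List ℤ)} (cd : Cond)
    {rows1 rows2 rows3 rows4 : List (List (ℕ × ℤ))} {piv1 piv2 piv3 piv4 : List ℕ}
    (hvan : condVanishR a b c T M1 M3 cd = true)
    (hcap1 : cd.1 = 1 →
      intTriCheckUnit (3 * r) (kyEntry4 b a c M1 (fun j i l => T i j l)) rows1 piv1 = true)
    (hcap2 : cd.1 = 2 →
      intTriCheckUnit (3 * r) (kyEntry4 b c a M1 (fun j l i => T i j l)) rows2 piv2 = true)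
    (hcap3 : cd.1 ≠ 1 → cd.1 ≠ 2 → cd.1 ≠ 4 →
      intTriCheckUnit (3 * r) (kyEntry4 c a b M3 (fun l i j => T i j l)) rows3 piv3 = true)
    (hcap4 : cd.1 = 4 →
      intTriCheckUnit (3 * r) (kyEntry4 c b a M3 (fun l j i => T i j l)) rows4 piv4 = true)
    (Z : Fin b → Fin c → K) (hle : algBorderRank (extendSlice (fun i j l => (T i j l : K)) Z) ≤ r) :
    ∑ j : Fin b, ∑ l : Fin c, (lamEntryR b c M1 M3 cd j l : K) * Z j l = 0 := by
  classical
  set tK : Fin a → Fin b → Fin c → K := fun i j l => (T i j l : K) with htK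
  -- the swapped tensor `(i, l, j) ↦ T i j l` with `Zᵀ` has the same extension border rank
  have hext : algBorderRank (extendSlice (fun i l j => tK i j l) fun l j => Z j l) ≤ r := by
    have e : (extendSlice (fun i l j => tK i j l) fun l j => Z j l) =
        fun x l j => extendSlice tK Z x j l := by
      funext x l j; cases x <;> rfl
    rw [e, algBorderRank_swap₂₃ (extendSlice tK Z)]
    exact hle
  by_cases h2 : cd.1 = 2
  · -- role 2: rows, exterior on the second factor
    unfold condVanishR at hvan
    simp only [h2, if_true] at hvan
    have hcap := le_rank_rowFlattening (K := K) T M1 (hcap2 h2)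
    have hx := rowFlattening_mulVec_eq_zero (K := K) T M1 cd.2.1 hvan
    have key := rowFlattening_condition 4 1 ((mat4 b M1).map (Int.cast : ℤ → K)) tK Z hle
      (by simpa using hcap) _ hx (pairOf4 (finCode 6 cd.2.2))
    simp only [lamEntryR, h2, if_true]
    rw [sum_lamRow_one]
    exact key
  by_cases h4 : cd.1 = 4
  · -- role 4: rows, exterior on the third factor = role 2 of the swapped tensor
    unfold condVanishR at hvan
    simp only [h4, if_true, show (4 : ℕ) ≠ 2 by decide, if_false] at hvan
    have hcap := le_rank_rowFlattening (K := K) (fun i l j => T i j l) M3 (hcap4 h4)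
    have hx := rowFlattening_mulVec_eq_zero (K := K) (fun i l j => T i j l) M3 cd.2.1 hvan
    have key := rowFlattening_condition 4 1 ((mat4 c M3).map (Int.cast : ℤ → K))
      (fun i l j => tK i j l) (fun l j => Z j l) hext (by simpa using hcap) _ hx
      (pairOf4 (finCode 6 cd.2.2))
    simp only [lamEntryR, h4, show (4 : ℕ) ≠ 2 by decide, if_false, if_true]
    rw [Finset.sum_comm, sum_lamRow_one]
    exact key
  -- roles 1 and 3: the source roles
  unfold condVanishR at hvan
  simp only [h2, h4, if_false] at hvan
  simp only [lamEntryR, h2, h4, if_false]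
  by_cases h1 : cd.1 = 1
  · simp only [condVanish, h1, if_true] at hvan
    have hcap := le_rank_srcFlattening (K := K) T M1 (hcap1 h1)
    have hy := vecMul_srcFlattening_eq_zero (K := K) T M1 cd.2.1 hvan
    have key := srcFlattening_condition 4 1 ((mat4 b M1).map (Int.cast : ℤ → K)) tK Z hle
      (by simpa using hcap) _ hy (singOf4 (finCode 4 cd.2.2))
    simp only [lamEntry, h1, if_true]
    rw [sum_lamEntry_one]
    exact key
  · simp only [condVanish, h1, if_false] at hvan
    have hcap := le_rank_srcFlattening (K := K) (fun i l j => T i j l) M3 (hcap3 h1 h2 h4)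
    have hy := vecMul_srcFlattening_eq_zero (K := K) (fun i l j => T i j l) M3 cd.2.1 hvan
    have key := srcFlattening_condition 4 1 ((mat4 c M3).map (Int.cast : ℤ → K))
      (fun i l j => tK i j l) (fun l j => Z j l) hext (by simpa using hcap) _ hy
      (singOf4 (finCode 4 cd.2.2))
    simp only [lamEntry, h1, if_false]
    rw [Finset.sum_comm, sum_lamEntry_one]
    exact key

/-- From the condition part of a four-role certificate: `Λ Z = 0` row by row. [folklore] -/
theorem sum_lamEntryR_getD_mul_eq_zero {a b c r : ℕ} [NeZero a] [NeZero b] [NeZero c]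
    (T : Fin a → Fin b → Fin c → ℤ) {M1 M3 : List (List ℤ)} {conds : List Cond}
    {rows1 rows2 rows3 rows4 : List (List (ℕ × ℤ))} {piv1 piv2 piv3 piv4 : List ℕ}
    (hconds : (conds.all fun cd => condVanishR a b c T M1 M3 cd) = true)
    (hcaps : capsR a b c r T M1 M3 conds rows1 piv1 rows2 piv2 rows3 piv3 rows4 piv4 = true)
    (Z : Fin b → Fin c → K) (hle : algBorderRank (extendSlice (fun i j l => (T i j l : K)) Z) ≤ r)
    (k : ℕ) :
    ∑ j : Fin b, ∑ l : Fin c, (lamEntryR b c M1 M3 (conds.getD k dflt) j l : K) * Z j l = 0 := by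
  classical
  rw [List.all_eq_true] at hconds
  unfold capsR at hcaps
  simp only [Bool.and_eq_true] at hcaps
  obtain ⟨⟨⟨hc1, hc2⟩, hc3⟩, hc4⟩ := hcaps
  by_cases hk : k < conds.length
  · have hmem : conds.getD k dflt ∈ conds := by
      rw [List.getD_eq_getElem?_getD, List.getElem?_eq_getElem hk, Option.getD_some]
      exact List.getElem_mem hk
    set cd := conds.getD k dflt with hcd
    refine sum_lamEntryR_mul_eq_zero (rows1 := rows1) (rows2 := rows2) (rows3 := rows3)
      (rows4 := rows4) (piv1 := piv1) (piv2 := piv2) (piv3 := piv3) (piv4 := piv4) T cd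
      (hconds cd hmem) ?_ ?_ ?_ ?_ Z hle
    · intro h1
      have hany : (conds.any fun cd => cd.1 == 1) = true :=
        List.any_eq_true.2 ⟨cd, hmem, by simp [h1]⟩
      simpa [hany] using hc1
    · intro h2
      have hany : (conds.any fun cd => cd.1 == 2) = true :=
        List.any_eq_true.2 ⟨cd, hmem, by simp [h2]⟩
      simpa [hany] using hc2
    · intro h1 h2 h4
      have hany : (conds.any fun cd => !(cd.1 == 1) && !(cd.1 == 2) && !(cd.1 == 4)) = true :=
        List.any_eq_true.2 ⟨cd, hmem, by simp [h1, h2, h4]⟩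
      simpa [hany] using hc3
    · intro h4
      have hany : (conds.any fun cd => cd.1 == 4) = true :=
        List.any_eq_true.2 ⟨cd, hmem, by simp [h4]⟩
      simpa [hany] using hc4
  · have hk' : conds.length ≤ k := le_of_not_gt hk
    have hcd : conds.getD k dflt = dflt := by
      rw [List.getD_eq_getElem?_getD, List.getElem?_eq_none hk', Option.getD_none]
    rw [hcd]
    simp [lamEntryR_dflt]

/-- The linear map `Λ : K^{b×c} → K^{bc}` of a four-role condition list. [folklore] -/
noncomputable def lamMapR (K : Type u) [Field K] (b c : ℕ) (M1 M3 : List (List ℤ))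
    (conds : List Cond) : (Fin b → Fin c → K) →ₗ[K] (Fin (b * c) → K) :=
  ((lamMatR b c M1 M3 conds).map (Int.cast : ℤ → K)).mulVecLin ∘ₗ
    (LinearEquiv.curry K K (Fin b) (Fin c)).symm.toLinearMap

/-- Entries of `Λ Z`. [folklore] -/
theorem lamMapR_apply (b c : ℕ) (M1 M3 : List (List ℤ)) (conds : List Cond)
    (Z : Fin b → Fin c → K) (k : Fin (b * c)) :
    lamMapR K b c M1 M3 conds Z k =
      ∑ j : Fin b, ∑ l : Fin c, (lamEntryR b c M1 M3 (conds.getD k dflt) j l : K) * Z j l := by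
  simp only [lamMapR, LinearMap.coe_comp, Function.comp_apply, Matrix.mulVecLin_apply,
    Matrix.mulVec, dotProduct, Fintype.sum_prod_type, Matrix.map_apply, lamMatR, Matrix.of_apply]
  rfl

/-- `rank Λ` from a unit-pivot row certificate of `lamCodeR`. [folklore] -/
theorem le_finrank_range_lamMapR {b c n : ℕ} [NeZero b] [NeZero c] {M1 M3 : List (List ℤ)}
    {conds : List Cond} {rowsL : List (List (ℕ × ℤ))} {pivL : List ℕ}
    (hL : intTriCheckUnit n (lamCodeR b c M1 M3 conds) rowsL pivL = true) :
    n ≤ Module.finrank K (LinearMap.range (lamMapR K b c M1 M3 conds)) := by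
  classical
  have htop : LinearMap.range (LinearEquiv.curry K K (Fin b) (Fin c)).symm.toLinearMap = ⊤ :=
    LinearEquiv.range _
  rw [lamMapR, LinearMap.range_comp_of_range_eq_top _ htop]
  have hneq : NeZero (b * c) := ⟨Nat.mul_ne_zero (NeZero.ne b) (NeZero.ne c)⟩
  exact le_rank_of_intTriCheckUnit (F := K) (lamMatR b c M1 M3 conds) (finCode (b * c))
    (slabDec b c) hL

/-- A code-level vanishing `∑_j ∑_l Λ_k(j,l) W(j,l) = 0` read in `K`. [folklore] -/
theorem lamMapR_apply_eq_zero_of_lsum {b c : ℕ} [NeZero b] [NeZero c] {M1 M3 : List (List ℤ)}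
    {conds : List Cond} (k : Fin (b * c)) (W : ℕ → ℕ → ℤ)
    (hW : (lsum b (fun j => lsum c fun l =>
      lamEntryR b c M1 M3 (conds.getD k dflt) j l * W j l) == 0) = true) :
    lamMapR K b c M1 M3 conds (fun j l => (W j l : K)) k = 0 := by
  rw [lamMapR_apply]
  rw [beq_iff_eq, lsum_eq] at hW
  simp only [lsum_eq] at hW
  have h3 := congrArg (Int.cast : ℤ → K) hW
  simpa [Int.cast_sum, Int.cast_mul] using h3

/-- `Λ` kills the slices (from `slicesKilledR`). [folklore] -/
theorem sliceSpan_le_ker_lamMapR {a b c : ℕ} [NeZero a] [NeZero b] [NeZero c]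
    (T : Fin a → Fin b → Fin c → ℤ) {M1 M3 : List (List ℤ)} {conds : List Cond}
    (hkill : slicesKilledR a b c T M1 M3 conds = true) :
    sliceSpan (fun i j l => (T i j l : K)) ≤ LinearMap.ker (lamMapR K b c M1 M3 conds) := by
  classical
  rw [sliceSpan, Submodule.span_le]
  rintro _ ⟨i, rfl⟩
  rw [SetLike.mem_coe, LinearMap.mem_ker]
  beta_reduce
  funext k
  rw [Pi.zero_apply]
  unfold slicesKilledR at hkill
  rw [List.all_eq_true] at hkill
  have h1 := hkill k (List.mem_range.2 k.isLt)
  rw [List.all_eq_true] at h1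
  have h2 := h1 i (List.mem_range.2 i.isLt)
  have hfa : finCode a (i : ℕ) = i := Fin.ext (Nat.mod_eq_of_lt i.isLt)
  have hfb : ∀ j : Fin b, finCode b (j : ℕ) = j := fun j => Fin.ext (Nat.mod_eq_of_lt j.isLt)
  have hfc : ∀ l : Fin c, finCode c (l : ℕ) = l := fun l => Fin.ext (Nat.mod_eq_of_lt l.isLt)
  simp only [hfa] at h2
  have h4 := lamMapR_apply_eq_zero_of_lsum (K := K) k (fun j l => T i (finCode b j) (finCode c l)) h2
  have e : (fun (j : Fin b) (l : Fin c) => (T i j l : K)) =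
      fun (j : Fin b) (l : Fin c) => (T i (finCode b j) (finCode c l) : K) := by
    funext j l; rw [hfb, hfc]
  rw [e]
  exact h4

/-- `dim K^{b×c} = b c`. [folklore] -/
theorem finrank_slices (b c : ℕ) : Module.finrank K (Fin b → Fin c → K) = b * c := by
  rw [Module.finrank_pi_fintype K]
  simp [Module.finrank_fintype_fun_eq_card]

/-- **Soundness of the depth-0 four-role certificate.** [cite: JagiellaJelisiejew2026Unrestrictions, Thm. 2.2] [cite: LandsbergOttaviani2015, Thm 2.1] -/
theorem lt_algBorderRank_of_checkR (K : Type u) [Field K] {a b c r : ℕ} [NeZero a] [NeZero b]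
    [NeZero c] (T : Fin a → Fin b → Fin c → ℤ) {M1 M3 : List (List ℤ)} {conds : List Cond}
    {rows1 rows2 rows3 rows4 rowsL rowsS : List (List (ℕ × ℤ))}
    {piv1 piv2 piv3 piv4 pivL pivS : List ℕ}
    (h : checkR a b c r T M1 M3 conds rows1 piv1 rows2 piv2 rows3 piv3 rows4 piv4 rowsL pivL rowsS
      pivS = true)
    (har : a < r) (hr : r ≤ algBorderRank (fun i j l => (T i j l : K))) :
    r < algBorderRank (fun i j l => (T i j l : K)) := by
  classical
  unfold checkR at h
  simp only [Bool.and_eq_true] at h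
  obtain ⟨⟨⟨⟨hconds, hcaps⟩, hkill⟩, hL⟩, hS⟩ := h
  set tK : Fin a → Fin b → Fin c → K := fun i j l => (T i j l : K) with htK
  refine lt_algBorderRank_of_card_lt_of_forall_extendSlice tK (by simpa using har) hr fun Z hZ => ?_
  by_contra hle'
  have hle : algBorderRank (extendSlice tK Z) ≤ r := le_of_not_gt hle'
  apply hZ
  have hΨZ : lamMapR K b c M1 M3 conds Z = 0 := by
    funext k
    rw [Pi.zero_apply, lamMapR_apply]
    exact sum_lamEntryR_getD_mul_eq_zero T hconds hcaps Z hle k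
  have hVdim : a ≤ Module.finrank K (sliceSpan tK) := by
    have hrk := le_rank_of_intTriCheckUnit (F := K) (slab₁ T) (finCode a) (slabDec b c) hS
    have em : (slab₁ T).map (Int.cast : ℤ → K) = slab₁ tK := rfl
    rw [em] at hrk
    have hli := linearIndependent_of_card_le_rank_slab₁ tK (by simpa using hrk)
    rw [sliceSpan, finrank_span_eq_card hli, Fintype.card_fin]
  have hdim : Module.finrank K (Fin b → Fin c → K) ≤ (b * c - a) + a := by
    rw [finrank_slices]; omega
  exact mem_of_le_ker_of_finrank _ (sliceSpan tK) (sliceSpan_le_ker_lamMapR T hkill) hdim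
    (le_finrank_range_lamMapR hL) hVdim hΨZ

/-- `optOfFin` on an old index. [folklore] -/
theorem optOfFin_castSucc (a : ℕ) (i : Fin a) : optOfFin a i.castSucc = some i := by
  unfold optOfFin
  rw [dif_pos (by simp [i.isLt])]
  rfl

/-- `optOfFin` on the new index. [folklore] -/
theorem optOfFin_last (a : ℕ) : optOfFin a (Fin.last a) = none := by
  unfold optOfFin
  rw [dif_neg (by simp)]

/-- The integer extension read in `K` is the relabelled `extendSlice`. [folklore] -/
theorem intCast_extendInt {a b c : ℕ} (T : Fin a → Fin b → Fin c → ℤ) (Z0 : List (List ℤ)) :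
    (fun i j l => (extendInt T Z0 i j l : K)) = fun i j l =>
      extendSlice (fun i j l => (T i j l : K)) (fun j l => (mget Z0 j l : K)) (optOfFin a i) j l := by
  funext i j l
  unfold extendInt extendSlice
  cases optOfFin a i <;> rfl

/-- `bR(T + e_new ⊗ Z₀)` on `Fin (a+1)` is at most (in fact equal to) `bR(extendSlice T Z₀)`.
[cite: ConnerGesmundoLandsbergVentura2022, §1.1] -/
theorem algBorderRank_extendInt_le {a b c : ℕ} (T : Fin a → Fin b → Fin c → ℤ) (Z0 : List (List ℤ)) :
    algBorderRank (fun i j l => (extendInt T Z0 i j l : K)) ≤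
      algBorderRank (extendSlice (fun i j l => (T i j l : K)) (fun j l => (mget Z0 j l : K))) := by
  rw [intCast_extendInt]
  exact algBorderRank_precomp_le _ (optOfFin a) id id

/-- **Soundness of the depth-1 (forced direction) four-role certificate.** [cite: JagiellaJelisiejew2026Unrestrictions, Thm. 2.2] [cite: LandsbergOttaviani2015, Thm 2.1] -/
theorem lt_algBorderRank_of_checkForcedR (K : Type u) [Field K] {a b c r : ℕ} [NeZero a] [NeZero b]
    [NeZero c] (T : Fin a → Fin b → Fin c → ℤ) (Z0 : List (List ℤ)) {M1 M3 : List (List ℤ)}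
    {conds : List Cond} {rows1 rows2 rows3 rows4 rowsL rowsS : List (List (ℕ × ℤ))}
    {piv1 piv2 piv3 piv4 pivL pivS : List ℕ}
    (h : checkForcedR a b c r T Z0 M1 M3 conds rows1 piv1 rows2 piv2 rows3 piv3 rows4 piv4 rowsL pivL
      rowsS pivS = true)
    (har : a < r) (hr : r ≤ algBorderRank (fun i j l => (T i j l : K)))
    (hZ0 : r < algBorderRank (fun i j l => (extendInt T Z0 i j l : K))) :
    r < algBorderRank (fun i j l => (T i j l : K)) := by
  classical
  unfold checkForcedR at h
  simp only [Bool.and_eq_true] at h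
  obtain ⟨⟨⟨⟨⟨hconds, hcaps⟩, hkill⟩, hZ0kill⟩, hL⟩, hS⟩ := h
  set tK : Fin a → Fin b → Fin c → K := fun i j l => (T i j l : K) with htK
  set Z0K : Fin b → Fin c → K := fun j l => (mget Z0 j l : K) with hZ0K
  set t'' : Fin (a + 1) → Fin b → Fin c → K := fun i j l => (extendInt T Z0 i j l : K) with ht''
  refine lt_algBorderRank_of_card_lt_of_forall_extendSlice tK (by simpa using har) hr fun Z hZ => ?_
  by_contra hle'
  have hle : algBorderRank (extendSlice tK Z) ≤ r := le_of_not_gt hle'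
  -- (1) Λ Z = 0
  have hΨZ : lamMapR K b c M1 M3 conds Z = 0 := by
    funext k
    rw [Pi.zero_apply, lamMapR_apply]
    exact sum_lamEntryR_getD_mul_eq_zero T hconds hcaps Z hle k
  -- (2) W := span of the a+1 slices of T + e ⊗ Z₀ lies in ker Λ
  have ht''cast : ∀ i : Fin a, t'' i.castSucc = tK i := by
    intro i; funext j l
    simp only [ht'', extendInt, optOfFin_castSucc, Option.elim_some, htK]
  have ht''last : t'' (Fin.last a) = Z0K := by
    funext j l
    simp only [ht'', extendInt, optOfFin_last, Option.elim_none, hZ0K]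
  have hW : Submodule.span K (Set.range t'') ≤ LinearMap.ker (lamMapR K b c M1 M3 conds) := by
    rw [Submodule.span_le]
    rintro _ ⟨i, rfl⟩
    induction i using Fin.lastCases with
    | last =>
      rw [SetLike.mem_coe, LinearMap.mem_ker, ht''last]
      funext k
      rw [Pi.zero_apply]
      unfold lamKillsR at hZ0kill
      rw [List.all_eq_true] at hZ0kill
      exact lamMapR_apply_eq_zero_of_lsum (K := K) k (fun j l => mget Z0 j l)
        (hZ0kill k (List.mem_range.2 k.isLt))
    | cast i =>
      rw [ht''cast]
      exact sliceSpan_le_ker_lamMapR T hkill (Submodule.subset_span ⟨i, rfl⟩)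
  -- (3) dim W = a + 1
  have hli : LinearIndependent K t'' := by
    have hrk := le_rank_of_intTriCheckUnit (F := K) (slab₁ (extendInt T Z0)) (finCode (a + 1))
      (slabDec b c) hS
    have em : (slab₁ (extendInt T Z0)).map (Int.cast : ℤ → K) = slab₁ t'' := rfl
    rw [em] at hrk
    exact linearIndependent_of_card_le_rank_slab₁ t'' (by simpa using hrk)
  have hWdim : a + 1 ≤ Module.finrank K (Submodule.span K (Set.range t'')) := by
    rw [finrank_span_eq_card hli, Fintype.card_fin]
  -- (4) dimension count: Z ∈ W
  have hdim : Module.finrank K (Fin b → Fin c → K) ≤ (b * c - a - 1) + (a + 1) := by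
    rw [finrank_slices]; omega
  have hZW : Z ∈ Submodule.span K (Set.range t'') :=
    mem_of_le_ker_of_finrank _ _ hW hdim (le_finrank_range_lamMapR hL) hWdim hΨZ
  -- (5) Z = l • Z₀ + (slices); l ≠ 0 since Z ∉ V; then bR(T + e ⊗ Z) = bR(T + e ⊗ Z₀) > r
  obtain ⟨d, hd⟩ := (Submodule.mem_span_range_iff_exists_fun K).1 hZW
  rw [Fin.sum_univ_castSucc] at hd
  simp only [ht''cast, ht''last] at hd
  by_cases hl : d (Fin.last a) = 0
  · apply hZ
    rw [← hd, hl, zero_smul, add_zero, sliceSpan]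
    exact Submodule.sum_mem _ fun i _ => Submodule.smul_mem _ _ (Submodule.subset_span ⟨i, rfl⟩)
  · have hcongr := algBorderRank_extendSlice_congr tK Z0K (fun i => d i.castSucc) hl
    rw [add_comm] at hd
    rw [hd] at hcongr
    have h1 := algBorderRank_extendInt_le (K := K) T Z0
    rw [← hcongr] at h1
    exact absurd (lt_of_lt_of_le hZ0 (h1.trans hle)) (lt_irrefl r)

end Sound

end SieveCert

end Literature.Computability.AlgebraicComplexity
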